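import Mathlib
import Summits.ValiantsHypothesis.ValiantsHypothesis.Theorems.LacunarySymmetroidMatrixDescartesCensusConfluentClosureThreeFour
import Summits.ValiantsHypothesis.ValiantsHypothesis.Theorems.LacunarySymmetroidMatrixDescartesCensusConfluentClosureChain

/-!
# `MatrixDescartes` census — confluent closure of door A at `(3,4)`, CHAIN FORM: 20 alternating sample values suffice

HONEST FRAMING.  Object-search cell `pub-symmetroid`, door-A companion item `Theses.LacunarySymmetroid.DoorA34 = PosRootLawAt 3 4 18`
(stmt-ValiantsHypothesis-19980; OPEN, typed, never asserted).  Repackaging of `…CensusConfluentClosureThreeFour` into the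
certificate shape a refuter produces: ONE strictly increasing chain of `20` abscissae (in `t = log x`) at which the confluent
`3 × 3` four-term determinant `det(S₀ + e^{a t}(A + t·B) + e^{c t} S₂)` alternates strictly in sign; the chain lemma
`Confluent.le_ncard_of_chain` of the `(2,6)` chain file is reused.  Nothing is decided: `DoorA34` stays OPEN, no register
moves, nothing bears on `MatrixDescartes` (stmt-ValiantsHypothesis-18050) or `VP ≠ VNP`.

* `not_posRootLawAt_3_4_18_of_confluent_chain`, `not_doorA34_of_confluent_chain`.

No confluent pencil with such a chain is claimed to exist.

[folklore] Elementary repackaging.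
-/

-- `Summit.ValiantsHypothesis.ValiantsHypothesis.…` repeats a component by the D-0017 layout
-- (single-conjunct summit), which the `dupNamespace` linter flags; the name is mandated.
set_option linter.dupNamespace false

namespace Summit.ValiantsHypothesis.ValiantsHypothesis.Theorems.LacunarySymmetroidMatrixDescartes.Census.RealExp.ConfluentThreeFour

open Filter Topology
open scoped BigOperators Matrix
open Summit.ValiantsHypothesis.ValiantsHypothesis.Theorems.MatrixDescartes.Negative (PosRootLawAt)
open Summit.ValiantsHypothesis.ValiantsHypothesis.Theorems.LacunarySymmetroidMatrixDescartes.Census.RealExp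
  (ncard_rpow_eq_ncard_exp not_posRootLawAt_three_iff)
open Summit.ValiantsHypothesis.ValiantsHypothesis.Theorems.LacunarySymmetroidMatrixDescartes.Census.RealExp.Confluent
  (le_ncard_of_chain)

/-- **A confluent nineteen in CHAIN form refutes the (3,4) law**: symmetric letters and `20` strictly increasing abscissae (in
`t = log x`) at which the confluent `3 × 3` determinant alternates strictly in sign ⇒ `¬ PosRootLawAt 3 4 18`. [folklore] -/
theorem not_posRootLawAt_3_4_18_of_confluent_chain (a c : ℝ) {S₀ A B S₂ : Matrix (Fin 3) (Fin 3) ℝ}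
    (h₀ : S₀.IsSymm) (hA : A.IsSymm) (hB : B.IsSymm) (h₂ : S₂.IsSymm)
    (p : Fin 20 → ℝ) (hp : StrictMono p)
    (hsign : ∀ i : Fin 19,
      (S₀ + Real.exp (a * p i.castSucc) • (A + p i.castSucc • B) + Real.exp (c * p i.castSucc) • S₂).det *
        (S₀ + Real.exp (a * p i.succ) • (A + p i.succ • B) + Real.exp (c * p i.succ) • S₂).det < 0) :
    ¬ PosRootLawAt 3 4 18 := by
  have hev : ∀ᶠ η in 𝓝[>] (0 : ℝ), 0 < η ∧ ∀ i : Fin 19,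
      (∑ l, Real.exp (((![0, a, a + η, c] : Fin 4 → ℝ) l) * p i.castSucc) •
          ((![S₀, A - η⁻¹ • B, η⁻¹ • B, S₂] : Fin 4 → Matrix (Fin 3) (Fin 3) ℝ) l)).det *
        (∑ l, Real.exp (((![0, a, a + η, c] : Fin 4 → ℝ) l) * p i.succ) •
          ((![S₀, A - η⁻¹ • B, η⁻¹ • B, S₂] : Fin 4 → Matrix (Fin 3) (Fin 3) ℝ) l)).det < 0 := by
    have hall : ∀ᶠ η in 𝓝[>] (0 : ℝ), ∀ i : Fin 19,
        (∑ l, Real.exp (((![0, a, a + η, c] : Fin 4 → ℝ) l) * p i.castSucc) •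
            ((![S₀, A - η⁻¹ • B, η⁻¹ • B, S₂] : Fin 4 → Matrix (Fin 3) (Fin 3) ℝ) l)).det *
          (∑ l, Real.exp (((![0, a, a + η, c] : Fin 4 → ℝ) l) * p i.succ) •
            ((![S₀, A - η⁻¹ • B, η⁻¹ • B, S₂] : Fin 4 → Matrix (Fin 3) (Fin 3) ℝ) l)).det < 0 := by
      refine eventually_all.2 fun i => ?_
      have hprod := (tendsto_det_approx a c S₀ A B S₂ (p i.castSucc)).mul
        (tendsto_det_approx a c S₀ A B S₂ (p i.succ))
      exact hprod.eventually (Iio_mem_nhds (hsign i))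
    filter_upwards [(self_mem_nhdsWithin : Set.Ioi (0 : ℝ) ∈ 𝓝[>] (0 : ℝ)), hall] with η hη h using ⟨hη, h⟩
  obtain ⟨η, -, hη⟩ := hev.exists
  set δ' : Fin 4 → ℝ := (![0, a, a + η, c] : Fin 4 → ℝ) with hδ'
  set S' : Fin 4 → Matrix (Fin 3) (Fin 3) ℝ :=
    (![S₀, A - η⁻¹ • B, η⁻¹ • B, S₂] : Fin 4 → Matrix (Fin 3) (Fin 3) ℝ) with hS'
  have hcount := (le_ncard_of_chain δ' S' (by norm_num : 0 < 19) p hp hη).2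
  rw [← ncard_rpow_eq_ncard_exp δ' S'] at hcount
  exact (not_posRootLawAt_three_iff 4 18).mpr ⟨δ', S', approxLetters_isSymm h₀ hA hB h₂ η, hcount⟩

/-- **Confluent closure of door A at `(3,4)`, chain form**: `20` strictly increasing abscissae with strictly alternating
confluent determinant values refute `Theses.LacunarySymmetroid.DoorA34`.  No such pencil is claimed; the door stays OPEN.
[folklore] -/
theorem not_doorA34_of_confluent_chain (a c : ℝ) {S₀ A B S₂ : Matrix (Fin 3) (Fin 3) ℝ}
    (h₀ : S₀.IsSymm) (hA : A.IsSymm) (hB : B.IsSymm) (h₂ : S₂.IsSymm)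
    (p : Fin 20 → ℝ) (hp : StrictMono p)
    (hsign : ∀ i : Fin 19,
      (S₀ + Real.exp (a * p i.castSucc) • (A + p i.castSucc • B) + Real.exp (c * p i.castSucc) • S₂).det *
        (S₀ + Real.exp (a * p i.succ) • (A + p i.succ • B) + Real.exp (c * p i.succ) • S₂).det < 0) :
    ¬ Summit.ValiantsHypothesis.ValiantsHypothesis.Theses.LacunarySymmetroid.DoorA34 := by
  intro hD
  exact not_posRootLawAt_3_4_18_of_confluent_chain a c h₀ hA hB h₂ p hp hsign fun d S hS => hD d S hS

end Summit.ValiantsHypothesis.ValiantsHypothesis.Theorems.LacunarySymmetroidMatrixDescartes.Census.RealExp.ConfluentThreeFour
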